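import Mathlib
import HarnessLib
import HarnessLib.Audit
import Summits.QuantumAdvantage.Statement
import Literature.Computability.Complexity.Promise
import Literature.Computability.Complexity.BoolEncodings
import Literature.Computability.QuantumComplexity.PauliExpansion
import Literature.Computability.Complexity.PromiseBPPClosureProofs
import Literature.Computability.Complexity.PromiseZPPProofs
import HarnessLib.Audit.Status.Attr

/-!
Route: NeedleThreshold

DORMANT since 2026-08-22T13:06:57Z (reconciler: no traction for 5.3 d (last activity item-evidence-added at 2026-08-17T04:07:09Z); parked, not closed — `ledger route dormant route-QuantumAdvantage-NeedleThreshold --off` to reactivate) — unstaffed, not closed; items shared with open routes are served there. `ledger route dormant <id> --off` reactivates.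

# Route NeedleThreshold — BQP ⊆ BPP if guided-Hamiltonian hardness reaches the needle threshold
1/log² n

REFUTATION-SIDE route (the deciding theorem concludes `¬ QuantumAdvantage`): X = NeedleBPP ∧
GuidedHardness, and X → BQP ⊆ BPP.
Object: the guided Pauli-Hamiltonian decision problem GLH(K, χ₀) (inlined in both cruxes as one
`PromiseProblem.ofEncoding …`):
instance = n qubits, a list of Pauli strings with weights p + q√2 (p, q ∈ ℤ; Λ := Σ|p + q√2| > 0,
the Pauli 1-norm), a SIGNED
SUBSET-STATE guide u = Σ ±e_x over an explicit list, thresholds a = α/(D+1) < b = β/(D+1) with b − a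
≥ ε_K(n) := 1/(K·(log₂ n)² + 1);
YES: some eigenvector of H with eigenvalue ≤ aΛ has overlap ≥ χ₀ with u/‖u‖; NO: spec H ≥ bΛ.
NeedleBPP (card needle-vs-window-harmonic-measure, T3): GLH(K, χ₀) ∈ PromiseBPP' for EVERY K and χ₀
> 0, because a spectral
DECISION against a positive spectral measure needs only a ONE-SIDED "needle" detector polynomial,
whose coefficient price is
(1/δ)^{O(1/√ε)} (Beurling exponent 1/2) instead of the (1/δ)^{O(1/ε)} of two-sided filters; fed by
the support item NeedleDetector.
GuidedHardness (the bet; card no-dinur-for-guided-hamiltonians' GGA weakened from constant precision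
to 1/log² n): for SOME K, χ₀ > 0
every BQP language Karp-reduces to GLH(K, χ₀).
Lean: `NeedleBPP ∧ GuidedHardness`

## Assembly
Pure logic over two PROVED tree theorems. Suppose L ∈ BQP and L ∉ BPP (a summit witness).
GuidedHardness gives K, χ₀ > 0 and a Karp
reduction ofLanguage L ≤ GLH(K, χ₀); NeedleBPP applied to NeedleDetector gives GLH(K, χ₀) ∈
PromiseBPP';
`Literature.Computability.Complexity.PromiseProblem.mem_PromiseBPP'_of_polyTimeReducible_holds`
(Goldreich 2006 §1.2; PromiseBPPClosureProofs)
gives ofLanguage L ∈ PromiseBPP', and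
`Literature.Computability.Complexity.ofLanguage_mem_PromiseBPP'_iff` (PromiseZPPProofs) gives
L ∈ BPP — contradiction. The deciding theorem `closes (h₁ : NeedleDetector) (h₂ : NeedleBPP) (h₃ :
GuidedHardness) : ¬ QuantumAdvantage`
is 5 lines and elaborates (rc 0, no sorry) in the planner's Sketch.lean; no `BPP ⊆ BQP` fact and no
promise→language lift (PlLift) is
needed in this direction. The Assembly item below records the same implication as a statement;
`closes` is the deciding object.

Rationale: WHY THIS LINE. The negative side of this summit has so far been attacked through circuits (routes
Dequantize, PauliFlat, RectangleFree,
InverterDequantization); this line goes through the PromiseBQP-complete GUIDED LOCAL HAMILTONIAN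
problem (GharibianLegall2022 Thm 2:
BQP-hard at relative precision 1/poly with an explicit subset-state guide) along the PRECISION axis,
where the classical frontier in print
is ε ≍ log(1/χ)/log n (arXiv:2410.21833 Thm 1: time poly(χ^{-1/ε}, n), two-sided rectangle filter +
4^deg coefficient bound). Imported
from approximation / potential theory: one-sided Chebyshev growth past an interval endpoint
(KuczynskiWozniakowski1992, MuscoMusco2015)
priced on the DATA circle |z| = 1 where sample-and-query moment estimators live (MontanaroShao2023
Prop 1.9), and Nevanlinna's two-constant
theorem on the disc slit along the excluded spectrum (Ransford1995 Thm 4.3.7), which shows the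
exponent 1/2 is final for linear moment
statistics (support MomentWall). Consequence: the classical threshold moves to ε ≍ (log(1/χ)/log
n)², so a collapse BQP ⊆ BPP needs guided
BQP-hardness only down to 1/log² n — strictly weaker than the constant-precision amplification
hypotheses in print
(WeggemansFolkertsmaCade2023 Thm 1.5, GharibianLegall2022 §1) or on the hub (card
no-dinur-for-guided-hamiltonians) — and the contrapositive
QuantumAdvantage → ¬GuidedHardness is a quantified no-go for guide-transporting gap amplification.
No spectral/probabilistic
reformulation of the summit itself is used; the dictionary is explicit: spectral measure of (H/Λ, u)
↔ positive measure on a chord of the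
unit disc, cost of a linear statistic ↔ max of the detector on the circle, decision ↔ one-sided
extremal problem.

RANKED CRUXES. #2 GuidedHardness (crux) — for some K : ℕ and χ₀ > 0, every language L ∈ BQP
Karp-reduces, as the promise problem ofLanguage L, to GLH(K, χ₀) — BQP-hardness of guided
ground-energy DECISIONS at relative precision 1/(K·(log₂ n)² + 1) with signed subset-state guides of
constant overlap (GharibianLegall2022 Thm 2 gives precision 1/poly; the missing step is a
guide-transporting amplification of the relative promise gap from 1/poly to 1/log² n; card
no-dinur-for-guided-hamiltonians, hypothesis GGA, weakened). [difficulty: open-problem] (why it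
might fail: With NeedleBPP it yields BQP ⊆ BPP. No guide-transporting amplification is known:
same-eigenstate gap amplification is black-box impossible beyond quadratic (SommaBoixo2013),
perturbative gadgets shrink relative gaps (arXiv:2302.11578 Thm 1.5), history states have relative
gap O(1/T).) [GharibianLegall2022, CadeEtAl2022, SommaBoixo2013, WeggemansFolkertsmaCade2023]
#3 NeedleBPP (crux) — (card T3) the needle detector — inlined as the antecedent, verbatim the
support item NeedleDetector — makes Le Gall's Pauli-path moment estimator a PromiseBPP' algorithm
for GLH(K, χ₀) for EVERY K and χ₀ > 0: with A = H/(2Λ) (spectrum in [−1/2, 1/2]) and detector p = Σ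
c_k x^k for (a/2, b/2, ε_K(n)/2, δ = χ₀²/4), estimate Σ_k c_k ⟨û|A^k|û⟩ from N = O(W² log d/χ₀⁴)
one-sample path estimates bounded by 1 (sample a Pauli path with probability Π|w|/Λ^k, evaluate
sgn·⟨û|P_path|û⟩ exactly on the guide's poly-size support), W := Σ|c_k| ≤ (8/χ₀²)^{O(√(K log² n +
1))} = n^{O(√K·log(8/χ₀²))}; accept iff the estimate is ≥ χ₀²/2 (YES ≥ χ₀² − δ, NO ≤ δ); thresholds
with a < −1 (reject) or b > 1 (accept) and u = 0 (reject) are decided outright. [deps: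
NeedleDetector] [difficulty: L] (why it might fail: Unprinted (hand + LP check only, card j000799).
Price must be the monomial ℓ¹-norm on the data circle (MontanaroShao2023 Prop 1.9) and stay
n^{O(√K)} through halving A, dyadic sampling of ℤ[√2] weights and the fixed coin budget; a hidden
4^deg factor (arXiv:2410.21833 Lem 3) restores exponent 1/ε.) [Gall2024, arXiv:2410.21833,
GharibianLegall2022, MontanaroShao2023]
#9 NeedleDetector (support) — (card T1-upper in O-form) there is C : ℕ such that for 0 < ε, 0 < δ ≤
1/2, −1/2 ≤ a < b ≤ 1/2, b − a ≥ ε some real polynomial p has deg p ≤ C·ln(2/δ)/√ε, Σ_i |coeff_i p|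
≤ (2/δ)^{C/√ε}, p ≥ 1 on [−1, a], p ≥ 0 on [a, b], |p| ≤ δ on [b, 1]. Intended proof: p =
T_d(y(x))/T_d(y(a)) with y affine taking [b, 1] onto [−1, 1], d = 2⌈ln(2/δ)/√ε⌉ even; Chebyshev
growth T_d(1 + t) ≥ e^{d√t}/2 for t = 2(b−a)/(1−b) ≥ 4ε/3 gives |p| ≤ δ on [b,1], monotonicity of
T_d on [1, ∞) gives p ≥ 1 on [−1, a] and 0 < p ≤ 1 on [a, b]; coefficients: Σ|coeff| ≤ (7(1+√2))^d ≤
17^d since |y| ≤ 7 on the unit circle; C = 12 works. The sharp constant h(a,b) of the card (crux K3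
there) is NOT needed. [difficulty: provable-now] [KuczynskiWozniakowski1992, MuscoMusco2015,
Gall2024]
#9 MomentWall (support) — (card T1-lower: the harmonic-measure price; S-side content, not a
hypothesis of `closes`) there is c > 0 such that for 0 < δ ≤ 1/2 and −1/2 ≤ a < b ≤ 1/2 every real
polynomial with p ≥ 1 on [−1, a] and |p| ≤ δ on [b, 1] has Σ_i |coeff_i p| ≥ (1/δ)^{c/√(b−a)}:
one-sided detectors cannot beat exponent 1/2, so within linear moment statistics the threshold of
NeedleBPP is final and the whole remaining burden of the line sits on GuidedHardness. Intended
proof: Σ|c_k| ≥ max_{|z|=1} |p(z)|; two-constant theorem for the subharmonic log|p| on the unit disc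
minus the needle [b, 1], evaluated at a, with the explicit slit-opening map z ↦ ((1+√φ)/(1−√φ))², φ
= (z−b)/(1−bz): log max ≥ h(a,b)·log(1/δ), h(a,b) = π/(4·arctan √((b−a)/(1−ab))) − 1, and
h(a,b)·√(b−a) is bounded below on the window (≈ 0.07 at (a,b) = (−1/2, 1/2), → (π/4)√(1−ab) as b − a
→ 0). [difficulty: L] [Ransford1995, arXiv:1605.09601, MontanaroShao2023]

TWO-LAYER PLAN. GuidedHardness ⇐ ClockHardness → GuidedAmplification → GuidedHardness (k = 2, glue =
`PromiseProblem.PolyTimeReducible.trans_holds`):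
ClockHardness = GharibianLegall2022 Thm 2 transcribed to this instance format at precision 1/(n^c +
c) (support, theorem in print: Kitaev
clock for Clifford+T, whose propagator terms have Pauli weights in 2^{-r}ℤ[√2] — hence the weight
ring — plus pre-idling and the
semi-classical subset-state guide over clock values); GuidedAmplification = a Karp reduction
GLH(1/poly) → GLH(1/log²) transporting signed
subset-state guides (the Hamiltonian-complexity bet proper, attackable with detectability-lemma /
code / tensor-power tools and killable
class-by-class by isoperimetry of history states and gadget gap-loss). NeedleBPP ⇐ MomentSampler
(exact poly-time evaluation of
⟨u|P|u⟩ for a Pauli string on a signed subset state + path sampling; unbiased, |X| ≤ 1) →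
DetectorToDecision (Hoeffding, threshold χ₀²/2,
the machine in the tree's PromiseBPP' coin model) → NeedleBPP (k = 2). Nothing here is filed now.

KILL CRITERIA. NeedleBPP refuted (the n^{O(√K)} bound fails for some threshold geometry, weight ring
or guide class as typed) kills the card's T3 and
the line: close `refuted:NeedleBPP`. NeedleDetector refuted (it is Chebyshev; a refutation would
mean the typed inequalities are
mis-normalised): restate once, else close. GuidedHardness cannot be refuted outright without
separating classes (¬GuidedHardness puts some
BQP language outside the Karp-closure of a PromiseBPP' problem); the realistic kills are conditional
and are RECORDED as S-side evidence,
after which the route goes dormant: (i) a theorem that every Karp reduction from a PromiseBQP-hard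
family into GLH(K, χ₀) factors through
a guide-transporting amplification of history-state Hamiltonians, plus the isoperimetric/gadget
no-gos for those; (ii) BQP-hardness of
GLH at 1/log² shown to collapse PH-type hierarchies. QuantumAdvantage proved elsewhere moots the
route and turns ¬GuidedHardness into a
theorem ("no guided amplification below relative precision (log(1/χ)/log n)²").

NOT DECOMPOSED YET. The sharp constant h(a,b) (card K3) and the EDGE regime (thresholds within O(ε)
of ±Λ, where h = O(1) and every precision is classical by
the power-method detector ((1−x)/2)^d) — neither is load-bearing; the adaptive minimax form of
MomentWall over all noisy-moment algorithms
(card K1, Le Cam + LP duality) and the sparse-query lift (card K2) — S-side refinements; the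
transcription of GharibianLegall2022 Thm 2 and
the bit-level probabilistic machine (layer-2 children above); k-locality of the terms (not needed by
NeedleBPP, so not imposed on
GuidedHardness — the reduction may output any Pauli list).

CHEAPEST FALSIFIER. Re-derive NeedleDetector with C = 12 on one page (T_d rescaled to [b,1], d
even): if Σ|coeff| of T_d(αx+β)/T_d(y(a)) with α ≤ 4, |β| ≤ 3
exceeded (2/δ)^{C/√ε} on the window the line is dead. Already run by the card's author (kit): LP for
the exact minimal one-sided weight,
b = 0, a = −ε, δ = 0.1: log₁₀ W₁* = 0.84, 1.61, 2.68, 4.21, 6.35 at ε = .32, .16, .08, .04, .02 —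
ratio per halving 1.91, 1.66, 1.57, 1.51
→ √2 (needle law) against ≥ 2.5 for two-sided filters (j000799); explicit detector at ε = .01, δ =
.1: degree 120, W = 10^{7.39}
(j001005). Lookup that would make GuidedHardness `known` or dead: a printed BQP-hardness of GLH at
precision 1/polylog (none:
GharibianLegall2022 Thm 2 and CadeEtAl2022 are 1/poly) or a printed classical GLH algorithm with
exponent o(1/ε) (none: arXiv:2410.21833,
arXiv:2409.04161, arXiv:2411.16163, arXiv:2207.10097 searched by the card's author and its refuter).

NUMBERS. Classical GLH: n^{O(log(1/χ)/ε)} (GharibianLegall2022 Thm 1); poly(χ^{-1/ε}, n)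
(arXiv:2410.21833 Thm 1); this line
poly(n)·(8/χ²)^{O(1/√ε)}, i.e. BPP for ε ≳ (log(1/χ)/log n)². Quantum: poly(1/χ, 1/ε, n) (phase
estimation, arXiv:2410.21833 Fact 1).
Hardness: BQP-hard for 6-local H, ‖H‖ ≤ 1, b − a = Ω(1/poly), subset-state guide with ‖Π_H u‖ ≥ δ
for any δ < 1/√2 − 1/poly
(GharibianLegall2022 Thm 2); overlap improved towards 1 − 1/poly in CadeEtAl2022. Needle exponent:
h(a,b) = π/(4 arctan√((b−a)/(1−ab))) − 1
≍ (π/4)√((1−ab)/ε); LP slopes d log W₁*/d log(1/δ) = 0.569, 1.129 at ε = .32, .16 vs h = 0.526,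
1.064 (card j000815). Items at open: 5
(2 cruxes, 2 support, 1 assembly).

DEFINITION REQUESTS. D1 (for MomentWall only): harmonic measure ω_Ω(z, E) of a boundary arc for
finitely connected planar domains (Perron solution) in
Literature/Analysis/Potential, with Nevanlinna's two-constant theorem (Ransford1995 Thm 4.3.7) as a
named fact over it; Mathlib has only the
Poisson kernel of the disc. D2 (convenience, for GuidedHardness/NeedleBPP):
`guidedPauliHamiltonianProblem (K : ℕ) (χ₀ : ℝ) : PromiseProblem`
in Literature/Computability/QuantumComplexity packaging the instance format inlined here (signed
subset-state guide, ℤ[√2] Pauli weights,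
thresholds α, β over D+1 relative to the Pauli 1-norm, precision 1/(K (log₂ n)² + 1)), so that
GharibianLegall2022 Thm 2 can be filed as a
cite fact against the same object; both filed with `ledger workitem add --kind definition` after
open.

Novelty: Searches (2026-08-15): `lit search "guided local Hamiltonian problem classical algorithm precision
overlap dequantization"` ×2 (searchd
rc 75, off-box service down); `lit galaxy search "guided local Hamiltonian" --star all` (5: Le Gall
ESA 2025 = arXiv:2410.21833, ZWY
arXiv:2411.16163, Gyurik–Dunjko 2306.16028, Mande–de Wolf 2305.04908, an NJP reprint); `lit galaxy
search "gap amplification preserving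
the guiding state" --star pdf` (0); `lit read arXiv:2410.21833` pp. 2–4 (Thm 1 poly(χ^{-1/ε}, n);
§1.2 cites Lanczos/KW92 only as
2^n-space explicit-vector methods; grep Chebyshev|Lanczos|optimal|lower bound: no one-sided filter,
no optimality claim for 1/ε);
`lit read arXiv:2111.09079` pp. 5–7 (Thm 2 verbatim: 6-local, b − a = Ω(1/poly), semi-classical
guide, δ < 1/√2); the spine card's own
search log (arXiv/S2: 2409.04161, 2207.10097, 2411.16163, 2302.11578, 2509.25815 — no exponent below
1/ε, no BQP-hardness at 1/polylog)
and two refuter audits of 2026-08-15 (needle card: "T3 … CORRECT and UNPRINTED", graded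
new-combination with prior KW92 / Musco–Musco /
Lanczos; no-dinur card: GGA → ¬S is the guided sibling of WFC Thm 1.5 / Aharonov–Grilo, graded
variant); `ledger negatives`; all 44
Theses files of the sub grepped for guided|Le Gall|GLH (0 routes).
Nearest prior art found: arXiv:2410.21833 Thm 1 (two-sided filter, exponent 1/ε, the frontier ε ≍
log(1/χ)/log n); KuczynskiWozniakowski1992
and MuscoMusco2015 (the Chebyshev/Lanczos square root for extreme eigenvalues with expli  [refs: 2410.21833, 2411.16163, 2111.09079, KuczynskiWozniakowski1992, MuscoMusco2015, WeggemansFolkertsmaCade2023, GharibianLegall2022]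

Barriers (technique_class: dequantization, one-sided-detector, gap-amplification): - technique_class: dequantization, one-sided-polynomial-detector, harmonic-measure,
hamiltonian-complexity, gap-amplification
- Literature.Barriers.QuantumAdvantage.Relativization: applies to the conclusion BQP ⊆ BPP
(`Relativization.not_relativizes_collapse_shape`: a PSPACE-complete oracle collapses, a BV/Simon
oracle separates), so the proof must be non-relativizing — and it is so by type, not by cleverness:
NeedleBPP consumes the explicit Pauli list and the guide's support, GuidedHardness is a Karp
reduction consuming the gate list of the uniform family (an oracle gate has no local-Hamiltonian
image); nothing here is asserted relative to oracles.
- Literature.Barriers.QuantumAdvantage.Algebrization: same verdict for the collapse direction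
(AaronsonWigderson2008 Thm 5.2): no arithmetization or low-degree extension is used; the white-box
reduction is outside the algebrizing class for the same reason as above.
- Literature.Barriers.QuantumAdvantage.TotalFunctionSpeedupLimit: not engaged — GLH is a promise
problem; consistently, MomentWall is itself a black-box (moment-oracle) exponential lower bound,
which is exactly why the line needs WHITE-BOX hardness transport (GuidedHardness) rather than a
better sampler.
- Literature.Barriers.QuantumAdvantage.SeparationPrerequisites: not engaged by a ¬S route (no
separation is claimed); it explains why GuidedHardness is not refutable outright (its negation
places a BQP language outside the Karp-closure of a PromiseBPP' problem, a P ≠ PS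

History (route lifecycle, newest last):
- 2026-08-22T13:06:57Z · DORMANT — reconciler: no traction for 5.3 d (last activity item-evidence-added at 2026-08-17T04:07:09Z); parked, not closed — `ledger route dormant route-QuantumAdvantage (operator:999:3749967)

sub-problem: QuantumAdvantage · status: dormant · opened planner-plancard-QuantumAdvantage-QuantumAdva-d316e098-0 2026-08-15T14:48:40Z · rev 2 · ledger route-QuantumAdvantage-NeedleThreshold
GENERATED by the gate from the ledger (D-0016/17). Provers cite these decls: `theorem foo : Summit.QuantumAdvantage.QuantumAdvantage.Theses.NeedleThreshold.<Decl> := …` in Summits/QuantumAdvantage/QuantumAdvantage/Theorems/<Name>.lean.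
-/

namespace Summit.QuantumAdvantage.QuantumAdvantage.Theses.NeedleThreshold

open scoped BigOperators Topology Manifold Classical MeasureTheory ProbabilityTheory Matrix InnerProductSpace ComplexConjugate ContinuousMap
open Filter Set Function TopologicalSpace MeasureTheory

attribute [summit_statement] _root_.QuantumAdvantage

open Literature.QuantumAdvantage

/-- item stmt-QuantumAdvantage-9895 · crux · rank 2 · open · by planner
why it might fail: With NeedleBPP it gives BQP ⊆ BPP. Printed guided BQP-hardness stops at 1/poly (GharibianLegall2022 Thm 2, CadeEtAl2022, arXiv:2509.25815); Λ/(K log² n) needs guide-preserving gap amplification: black-box ≤ quadratic (SommaBoixo2013), gadgets barred at O(1) unless QCMA=NP (arXiv:2302.11578 Thm 1.5).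
sources: GharibianLegall2022, CadeEtAl2022, arXiv:2509.25815, SommaBoixo2013, WeggemansFolkertsmaCade2023
[crux] for some K : ℕ and χ₀ > 0, every language L ∈ BQP Karp-reduces, as the promise problem
ofLanguage L, to GLH(K, χ₀) — BQP-hardness of guided ground-energy DECISIONS at relative precision
1/(K·(log₂ n)² + 1) with signed subset-state guides of constant overlap (GharibianLegall2022 Thm 2
gives precision 1/poly; the missing step is a guide-transporting amplification of the relative
promise gap from 1/poly to 1/log² n; card no-dinur-for-guided-hamiltonians, hypothesis GGA,
weakened). [difficulty: open-problem] -/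
@[route_item "route-QuantumAdvantage-NeedleThreshold", crux]
def GuidedHardness : Prop :=
  ∃ (K : ℕ) (χ₀ : ℝ), 0 < χ₀ ∧ ∀ L ∈ Literature.Computability.Cryptography.BQP, (Literature.Computability.Complexity.PromiseProblem.ofLanguage L).PolyTimeReducible (Literature.Computability.Complexity.PromiseProblem.ofEncoding (Computability.Encoding.sigmaBool (F := fun n : ℕ => List ((ℤ × ℤ) × ((Fin n → Bool) × (Fin n → Bool))) × (List (Bool × (Fin n → Bool)) × (ℤ × ℤ × ℕ))) (fun n : ℕ => (((Literature.Computability.Complexity.encodingIntBool.pairBool Literature.Computability.Complexity.encodingIntBool).pairBool ((Literature.Computability.Complexity.encodingBitVec n).pairBool (Literature.Computability.Complexity.encodingBitVec n))).listBool).pairBool (((Computability.encodingBoolBool.pairBool (Literature.Computability.Complexity.encodingBitVec n)).listBool).pairBool (Literature.Computability.Complexity.encodingIntBool.pairBool (Literature.Computability.Complexity.encodingIntBool.pairBool Computability.encodingNatBool))))) {I | ∃ (n : ℕ) (terms : List ((ℤ × ℤ) × ((Fin n → Bool) × (Fin n → Bool)))) (guide : List (Bool × (Fin n → Bool))) (α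 β : ℤ) (D : ℕ), I = ⟨n, (terms, (guide, (α, (β, D))))⟩ ∧ let H : Matrix (Fin n → Bool) (Fin n → Bool) ℂ := (terms.map fun t => ((((t.1.1 : ℝ) + (t.1.2 : ℝ) * Real.sqrt 2 : ℝ) : ℂ) • Literature.Computability.QuantumComplexity.pauliString fun i => if t.2.1 i then (if t.2.2 i then Literature.Computability.QuantumComplexity.Pauli.Y else Literature.Computability.QuantumComplexity.Pauli.X) else (if t.2.2 i then Literature.Computability.QuantumComplexity.Pauli.Z else Literature.Computability.QuantumComplexity.Pauli.I))).sum; let Λ : ℝ := (terms.map fun t => |(t.1.1 : ℝ) + (t.1.2 : ℝ) * Real.sqrt 2|).sum; let u : (Fin n → Bool) → ℂ := fun y => (guide.map fun g => if g.2 = y then (if g.1 then (-1 : ℂ) else 1) else 0).sum; 0 < Λ ∧ ((D : ℝ) + 1) ≤ ((β : ℝ) - α) * (((K : ℕ) : ℝ) * (Nat.log 2 n : ℝ) ^ 2 + 1) ∧ 0 < ∑ y, ‖u y‖ ^ 2 ∧ ∃ (l : ℝ) (v : (Fin n → Bool) → ℂ), v ≠ 0 ∧ H.mulVec v = (l : ℂ)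 • v ∧ l * ((D : ℝ) + 1) ≤ (α : ℝ) * Λ ∧ (χ₀ : ℝ) ^ 2 * (∑ y, ‖u y‖ ^ 2) * (∑ y, ‖v y‖ ^ 2) ≤ ‖∑ y, star (u y) * v y‖ ^ 2} {I | ∃ (n : ℕ) (terms : List ((ℤ × ℤ) × ((Fin n → Bool) × (Fin n → Bool)))) (guide : List (Bool × (Fin n → Bool))) (α β : ℤ) (D : ℕ), I = ⟨n, (terms, (guide, (α, (β, D))))⟩ ∧ let H : Matrix (Fin n → Bool) (Fin n → Bool) ℂ := (terms.map fun t => ((((t.1.1 : ℝ) + (t.1.2 : ℝ) * Real.sqrt 2 : ℝ) : ℂ) • Literature.Computability.QuantumComplexity.pauliString fun i => if t.2.1 i then (if t.2.2 i then Literature.Computability.QuantumComplexity.Pauli.Y else Literature.Computability.QuantumComplexity.Pauli.X) else (if t.2.2 i then Literature.Computability.QuantumComplexity.Pauli.Z else Literature.Computability.QuantumComplexity.Pauli.I))).sum; let Λ : ℝ := (terms.map fun t => |(t.1.1 : ℝ) + (t.1.2 : ℝ) * Real.sqrt 2|).sum; 0 < Λ ∧ ((D : ℝ) + 1) ≤ ((β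 : ℝ) - α) * (((K : ℕ) : ℝ) * (Nat.log 2 n : ℝ) ^ 2 + 1) ∧ ∀ (l : ℝ) (v : (Fin n → Bool) → ℂ), v ≠ 0 → H.mulVec v = (l : ℂ) • v → (β : ℝ) * Λ ≤ l * ((D : ℝ) + 1)})

/-- item stmt-QuantumAdvantage-9896 · crux · rank 3 · open · by planner
why it might fail: Unprinted; printed GLH algorithms have exponent 1/ε (GharibianLegall2022 Thm 1, arXiv:2410.21833 Thm 1). As typed one P-predicate on (input,coins) per (K,χ₀) must handle irrational ℤ[√2] weights, ℤ-amplitude guides, all thresholds; false if the one-sided detector's ℓ¹-price isn't 2^O(ln(2/δ)/√ε).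
sources: Gall2024, arXiv:2410.21833, GharibianLegall2022, MontanaroShao2023, KuczynskiWozniakowski1992
[crux] (card T3) the needle detector — inlined as the antecedent, verbatim the support item
NeedleDetector — makes Le Gall's Pauli-path moment estimator a PromiseBPP' algorithm for GLH(K, χ₀)
for EVERY K and χ₀ > 0: with A = H/(2Λ) (spectrum in [−1/2, 1/2]) and detector p = Σ c_k x^k for
(a/2, b/2, ε_K(n)/2, δ = χ₀²/4), estimate Σ_k c_k ⟨û|A^k|û⟩ from N = O(W² log d/χ₀⁴) one-sample path
estimates bounded by 1 (sample a Pauli path with probability Π|w|/Λ^k, evaluate sgn·⟨û|P_path|û⟩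
exactly on the guide's poly-size support), W := Σ|c_k| ≤ (8/χ₀²)^{O(√(K log² n + 1))} =
n^{O(√K·log(8/χ₀²))}; accept iff the estimate is ≥ χ₀²/2 (YES ≥ χ₀² − δ, NO ≤ δ); thresholds with a
< −1 (reject) or b > 1 (accept) and u = 0 (reject) are decided outright. [deps: NeedleDetector]
[difficulty: L] -/
@[route_item "route-QuantumAdvantage-NeedleThreshold", crux]
def NeedleBPP : Prop :=
  (∃ C : ℕ, ∀ ε δ a b : ℝ, 0 < ε → 0 < δ → δ ≤ 1 / 2 → -(1 / 2 : ℝ) ≤ a → a < b → b ≤ 1 / 2 → ε ≤ b - a → ∃ p : Polynomial ℝ, (p.natDegree : ℝ) ≤ C * Real.log (2 / δ) / Real.sqrt ε ∧ (∑ i ∈ Finset.range (p.natDegree + 1), |p.coeff i|) ≤ (2 / δ) ^ ((C : ℝ) / Real.sqrt ε) ∧ (∀ x ∈ Set.Icc (-1 : ℝ) a, 1 ≤ p.eval x) ∧ (∀ x ∈ Set.Icc a b, 0 ≤ p.eval x) ∧ (∀ x ∈ Set.Icc b 1, |p.eval x| ≤ δ)) → ∀ (K : ℕ) (χ₀ :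 ℝ), 0 < χ₀ → Literature.Computability.Complexity.PromiseProblem.ofEncoding (Computability.Encoding.sigmaBool (F := fun n : ℕ => List ((ℤ × ℤ) × ((Fin n → Bool) × (Fin n → Bool))) × (List (Bool × (Fin n → Bool)) × (ℤ × ℤ × ℕ))) (fun n : ℕ => (((Literature.Computability.Complexity.encodingIntBool.pairBool Literature.Computability.Complexity.encodingIntBool).pairBool ((Literature.Computability.Complexity.encodingBitVec n).pairBool (Literature.Computability.Complexity.encodingBitVec n))).listBool).pairBool (((Computability.encodingBoolBool.pairBool (Literature.Computability.Complexity.encodingBitVec n)).listBool).pairBool (Literature.Computability.Complexity.encodingIntBool.pairBool (Literature.Computability.Complexity.encodingIntBool.pairBool Computability.encodingNatBool))))) {I | ∃ (n : ℕ) (terms : List ((ℤ × ℤ) × ((Fin n → Bool) × (Fin n → Bool)))) (guide : List (Bool × (Fin n → Bool))) (α β : ℤ) (D : ℕ), I = ⟨n, (terms, (guide, (α, (β, D))))⟩ ∧ let H : Matrix (Fin n → Bool) (Fin n → Bool) ℂ := (terms.map fun t => ((((t.1.1 : ℝ) + (t.1.2 : ℝ) * Real.sqrt 2 : ℝ) :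 ℂ) • Literature.Computability.QuantumComplexity.pauliString fun i => if t.2.1 i then (if t.2.2 i then Literature.Computability.QuantumComplexity.Pauli.Y else Literature.Computability.QuantumComplexity.Pauli.X) else (if t.2.2 i then Literature.Computability.QuantumComplexity.Pauli.Z else Literature.Computability.QuantumComplexity.Pauli.I))).sum; let Λ : ℝ := (terms.map fun t => |(t.1.1 : ℝ) + (t.1.2 : ℝ) * Real.sqrt 2|).sum; let u : (Fin n → Bool) → ℂ := fun y => (guide.map fun g => if g.2 = y then (if g.1 then (-1 : ℂ) else 1) else 0).sum; 0 < Λ ∧ ((D : ℝ) + 1) ≤ ((β : ℝ) - α) * (((K : ℕ) : ℝ) * (Nat.log 2 n : ℝ) ^ 2 + 1) ∧ 0 < ∑ y, ‖u y‖ ^ 2 ∧ ∃ (l : ℝ) (v : (Fin n → Bool) → ℂ), v ≠ 0 ∧ H.mulVec v = (l : ℂ) • v ∧ l * ((D : ℝ) + 1) ≤ (α : ℝ) * Λ ∧ (χ₀ : ℝ) ^ 2 * (∑ y, ‖u y‖ ^ 2) * (∑ y, ‖v y‖ ^ 2) ≤ ‖∑ y, star (u y) * v y‖ ^ 2} {I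 | ∃ (n : ℕ) (terms : List ((ℤ × ℤ) × ((Fin n → Bool) × (Fin n → Bool)))) (guide : List (Bool × (Fin n → Bool))) (α β : ℤ) (D : ℕ), I = ⟨n, (terms, (guide, (α, (β, D))))⟩ ∧ let H : Matrix (Fin n → Bool) (Fin n → Bool) ℂ := (terms.map fun t => ((((t.1.1 : ℝ) + (t.1.2 : ℝ) * Real.sqrt 2 : ℝ) : ℂ) • Literature.Computability.QuantumComplexity.pauliString fun i => if t.2.1 i then (if t.2.2 i then Literature.Computability.QuantumComplexity.Pauli.Y else Literature.Computability.QuantumComplexity.Pauli.X) else (if t.2.2 i then Literature.Computability.QuantumComplexity.Pauli.Z else Literature.Computability.QuantumComplexity.Pauli.I))).sum; let Λ : ℝ := (terms.map fun t => |(t.1.1 : ℝ) + (t.1.2 : ℝ) * Real.sqrt 2|).sum; 0 < Λ ∧ ((D : ℝ) + 1) ≤ ((β : ℝ) - α) * (((K : ℕ) : ℝ) * (Nat.log 2 n : ℝ) ^ 2 + 1) ∧ ∀ (l : ℝ) (v : (Fin n → Bool) → ℂ), v ≠ 0 → H.mulVec v = (l : ℂ) • v → (β : ℝ) * Λ ≤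 l * ((D : ℝ) + 1)} ∈ Literature.Computability.Complexity.PromiseBPP'

/-- item stmt-QuantumAdvantage-9897 · support · rank 9 · open · by planner
sources: KuczynskiWozniakowski1992, MuscoMusco2015, Gall2024
[support] (card T1-upper in O-form) there is C : ℕ such that for 0 < ε, 0 < δ ≤ 1/2, −1/2 ≤ a < b ≤
1/2, b − a ≥ ε some real polynomial p has deg p ≤ C·ln(2/δ)/√ε, Σ_i |coeff_i p| ≤ (2/δ)^{C/√ε}, p ≥
1 on [−1, a], p ≥ 0 on [a, b], |p| ≤ δ on [b, 1]. Intended proof: p = T_d(y(x))/T_d(y(a)) with y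
affine taking [b, 1] onto [−1, 1], d = 2⌈ln(2/δ)/√ε⌉ even; Chebyshev growth T_d(1 + t) ≥ e^{d√t}/2
for t = 2(b−a)/(1−b) ≥ 4ε/3 gives |p| ≤ δ on [b,1], monotonicity of T_d on [1, ∞) gives p ≥ 1 on
[−1, a] and 0 < p ≤ 1 on [a, b]; coefficients: Σ|coeff| ≤ (7(1+√2))^d ≤ 17^d since |y| ≤ 7 on the
unit circle; C = 12 works. The sharp constant h(a,b) of the card (crux K3 there) is NOT needed.
[difficulty: provable-now] -/
@[route_item "route-QuantumAdvantage-NeedleThreshold", crux]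
def NeedleDetector : Prop :=
  ∃ C : ℕ, ∀ ε δ a b : ℝ, 0 < ε → 0 < δ → δ ≤ 1 / 2 → -(1 / 2 : ℝ) ≤ a → a < b → b ≤ 1 / 2 → ε ≤ b - a → ∃ p : Polynomial ℝ, (p.natDegree : ℝ) ≤ C * Real.log (2 / δ) / Real.sqrt ε ∧ (∑ i ∈ Finset.range (p.natDegree + 1), |p.coeff i|) ≤ (2 / δ) ^ ((C : ℝ) / Real.sqrt ε) ∧ (∀ x ∈ Set.Icc (-1 : ℝ) a, 1 ≤ p.eval x) ∧ (∀ x ∈ Set.Icc a b, 0 ≤ p.eval x) ∧ (∀ x ∈ Set.Icc b 1, |p.eval x| ≤ δ)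

/-- item stmt-QuantumAdvantage-9898 · support · rank 9 · open · by planner
sources: Ransford1995, arXiv:1605.09601, MontanaroShao2023
[support] (card T1-lower: the harmonic-measure price; S-side content, not a hypothesis of `closes`)
there is c > 0 such that for 0 < δ ≤ 1/2 and −1/2 ≤ a < b ≤ 1/2 every real polynomial with p ≥ 1 on
[−1, a] and |p| ≤ δ on [b, 1] has Σ_i |coeff_i p| ≥ (1/δ)^{c/√(b−a)}: one-sided detectors cannot
beat exponent 1/2, so within linear moment statistics the threshold of NeedleBPP is final and the
whole remaining burden of the line sits on GuidedHardness. Intended proof: Σ|c_k| ≥ max_{|z|=1}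
|p(z)|; two-constant theorem for the subharmonic log|p| on the unit disc minus the needle [b, 1],
evaluated at a, with the explicit slit-opening map z ↦ ((1+√φ)/(1−√φ))², φ = (z−b)/(1−bz): log max ≥
h(a,b)·log(1/δ), h(a,b) = π/(4·arctan √((b−a)/(1−ab))) − 1, and h(a,b)·√(b−a) is bounded below on
the window (≈ 0.07 at (a,b) = (−1/2, 1/2), → (π/4)√(1−ab) as b − a → 0). [difficulty: L] -/
@[route_item "route-QuantumAdvantage-NeedleThreshold"]
def MomentWall : Prop :=
  ∃ c : ℝ, 0 < c ∧ ∀ δ a b : ℝ, 0 < δ → δ ≤ 1 / 2 → -(1 / 2 : ℝ) ≤ a → a < b → b ≤ 1 / 2 → ∀ p : Polynomial ℝ, (∀ x ∈ Set.Icc (-1 : ℝ) a, 1 ≤ p.eval x) → (∀ x ∈ Set.Icc b 1, |p.eval x| ≤ δ) → (1 / δ) ^ (c / Real.sqrt (b - a)) ≤ ∑ i ∈ Finset.range (p.natDegree + 1), |p.coeff i|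

/-- item stmt-QuantumAdvantage-9899 · assembly · rank 1 · open · by planner
sources: GharibianLegall2022, Gall2024, Goldreich2006
[assembly] NeedleDetector → NeedleBPP → GuidedHardness → ¬ QuantumAdvantage (refutation side; proof
= the 5-line `closes`). -/
@[route_item "route-QuantumAdvantage-NeedleThreshold"]
def Assembly : Prop :=
  NeedleDetector → NeedleBPP → GuidedHardness → ¬ QuantumAdvantage

/-! D-0027 §2.1 — DECIDING THEOREM (planner-authored via `route open/edit --closes-file`; by planner-plancard-QuantumAdvantage-QuantumAdva-d316e098-0 2026-08-15T14:48:41Z):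
its hypotheses are this route's items and its conclusion the sub-problem Statement (glue_lint), and it elaborates with this file. -/

@[closes "route-QuantumAdvantage-NeedleThreshold"] theorem closes (h₁ : NeedleDetector) (h₂ : NeedleBPP) (h₃ : GuidedHardness) : ¬ QuantumAdvantage := by
  rintro ⟨L, hL, hLn⟩
  obtain ⟨K, χ₀, hχ, hhard⟩ := h₃
  exact hLn (Literature.Computability.Complexity.ofLanguage_mem_PromiseBPP'_iff.1
    (Literature.Computability.Complexity.PromiseProblem.mem_PromiseBPP'_of_polyTimeReducible_holds _ _
      (hhard L hL) (h₂ h₁ K χ₀ hχ)))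

end Summit.QuantumAdvantage.QuantumAdvantage.Theses.NeedleThreshold
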